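import Mathlib.Geometry.Manifold.VectorBundle.Tangent
import Mathlib.Geometry.Manifold.VectorBundle.Basic
import Mathlib.Geometry.Manifold.ContMDiff.NormedSpace
import Mathlib.Geometry.Manifold.Algebra.LieGroup
import Mathlib.Geometry.Manifold.Algebra.SMul
import HarnessLib

/-!
# Linear combinations of smooth lifts to the tangent bundle along a map

Bookkeeping for the programme `Literature.Geometry.Riemannian.lee_expMap_injectivityDomain`
(Lee 2018, Thm. 10.34): if `a ↦ (c a, Z a) ∈ TM` and `a ↦ (c a, Z' a) ∈ TM` are `C^k` lifts of one
map `c : N → M` and `f : N → ℝ` is `C^k`, then so are `a ↦ (c a, Z a + Z' a)` and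
`a ↦ (c a, f a • Z a)` — read in the trivialisation at `c a₀`, whose fibre maps are linear
(O'Neill 1983, Ch. 4, p. 122: vector fields along a map form a module over the smooth functions).
No definitions, no named facts (D-0026).

## References

* B. O'Neill, *Semi-Riemannian geometry* (1983), Ch. 4, p. 122. [ONeill1983]
* J. M. Lee, *Introduction to Riemannian Manifolds*, 2nd ed. (2018), pp. 100–101 (vector fields
  along curves and maps). [LeeRiemannianManifolds2018]
-/

noncomputable section

open Bundle Set Filter Function
open scoped Manifold ContDiff Topology

namespace Literature.Geometry.Riemannian

variable {E : Type*} [NormedAddCommGroup E] [NormedSpace ℝ E] {H : Type*} [TopologicalSpace H]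
  {I : ModelWithCorners ℝ E H} {M : Type*} [TopologicalSpace M] [ChartedSpace H M]
  [IsManifold I ∞ M]
  {E' : Type*} [NormedAddCommGroup E'] [NormedSpace ℝ E'] {H' : Type*} [TopologicalSpace H']
  {J : ModelWithCorners ℝ E' H'} {N : Type*} [TopologicalSpace N] [ChartedSpace H' N]
  {k : ℕ∞ω}

/-- **Scalar multiples of smooth lifts are smooth lifts**: if `a ↦ (c a, Z a) ∈ TM` is `C^k` at
`a₀` and `f` is `C^k` at `a₀`, then `a ↦ (c a, f a • Z a)` is `C^k` at `a₀` (in the trivialisation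
at `c a₀` the fibre coordinate is `f a • (fibre coordinate of Z a)`). O'Neill 1983, Ch. 4, p. 122.
[cite: ONeill1983, Ch. 4, p. 122] -/
theorem contMDiffAt_liftAlong_smul {c : N → M} {Z : Π a : N, TangentSpace I (c a)} {f : N → ℝ} {a₀ : N}
    (hZ : ContMDiffAt J I.tangent k (fun a ↦ (TotalSpace.mk' E (c a) (Z a) : TangentBundle I M)) a₀)
    (hf : ContMDiffAt J 𝓘(ℝ, ℝ) k f a₀) :
    ContMDiffAt J I.tangent k
      (fun a ↦ (TotalSpace.mk' E (c a) (f a • Z a) : TangentBundle I M)) a₀ := by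
  set e := trivializationAt E (TangentSpace I : M → Type _) (c a₀) with he_def
  have hZ' := contMDiffAt_totalSpace.1 hZ
  have hc : ContMDiffAt J I k c a₀ := hZ'.1
  have h2 : ContMDiffAt J 𝓘(ℝ, E) k
      (fun a ↦ (e (TotalSpace.mk' E (c a) (Z a) : TangentBundle I M)).2) a₀ := hZ'.2
  rw [contMDiffAt_totalSpace]
  refine ⟨hc, ?_⟩
  have hev : ∀ᶠ a in 𝓝 a₀, c a ∈ e.baseSet :=
    hc.continuousAt.preimage_mem_nhds
      (e.open_baseSet.mem_nhds (FiberBundle.mem_baseSet_trivializationAt' (c a₀)))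
  have heq : (fun a ↦ (e (TotalSpace.mk' E (c a) (f a • Z a) : TangentBundle I M)).2) =ᶠ[𝓝 a₀]
      fun a ↦ f a • (e (TotalSpace.mk' E (c a) (Z a) : TangentBundle I M)).2 := by
    filter_upwards [hev] with a ha
    rw [← e.continuousLinearMapAt_apply_of_mem ℝ ha, ← e.continuousLinearMapAt_apply_of_mem ℝ ha,
      map_smul]
  exact (hf.smul h2).congr_of_eventuallyEq heq

/-- Global form of `contMDiffAt_liftAlong_smul`. [cite: ONeill1983, Ch. 4, p. 122] -/
theorem contMDiff_liftAlong_smul {c : N → M} {Z : Π a : N, TangentSpace I (c a)} {f : N → ℝ}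
    (hZ : ContMDiff J I.tangent k (fun a ↦ (TotalSpace.mk' E (c a) (Z a) : TangentBundle I M)))
    (hf : ContMDiff J 𝓘(ℝ, ℝ) k f) :
    ContMDiff J I.tangent k (fun a ↦ (TotalSpace.mk' E (c a) (f a • Z a) : TangentBundle I M)) :=
  fun a ↦ contMDiffAt_liftAlong_smul (hZ a) (hf a)

/-- **Sums of smooth lifts of one map are smooth lifts**: if `a ↦ (c a, Z₁ a)` and
`a ↦ (c a, Z₂ a)` are `C^k` at `a₀`, so is `a ↦ (c a, Z₁ a + Z₂ a)` (fibrewise linearity of the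
trivialisation at `c a₀`). O'Neill 1983, Ch. 4, p. 122. [cite: ONeill1983, Ch. 4, p. 122] -/
theorem contMDiffAt_liftAlong_add {c : N → M} {Z₁ Z₂ : Π a : N, TangentSpace I (c a)} {a₀ : N}
    (h₁ : ContMDiffAt J I.tangent k (fun a ↦ (TotalSpace.mk' E (c a) (Z₁ a) : TangentBundle I M)) a₀)
    (h₂ : ContMDiffAt J I.tangent k (fun a ↦ (TotalSpace.mk' E (c a) (Z₂ a) : TangentBundle I M)) a₀) :
    ContMDiffAt J I.tangent k
      (fun a ↦ (TotalSpace.mk' E (c a) (Z₁ a + Z₂ a) : TangentBundle I M)) a₀ := by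
  set e := trivializationAt E (TangentSpace I : M → Type _) (c a₀) with he_def
  have h₁' := contMDiffAt_totalSpace.1 h₁
  have h₂' := contMDiffAt_totalSpace.1 h₂
  have hc : ContMDiffAt J I k c a₀ := h₁'.1
  rw [contMDiffAt_totalSpace]
  refine ⟨hc, ?_⟩
  have hev : ∀ᶠ a in 𝓝 a₀, c a ∈ e.baseSet :=
    hc.continuousAt.preimage_mem_nhds
      (e.open_baseSet.mem_nhds (FiberBundle.mem_baseSet_trivializationAt' (c a₀)))
  have heq : (fun a ↦ (e (TotalSpace.mk' E (c a) (Z₁ a + Z₂ a) : TangentBundle I M)).2) =ᶠ[𝓝 a₀]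
      fun a ↦ (e (TotalSpace.mk' E (c a) (Z₁ a) : TangentBundle I M)).2 +
        (e (TotalSpace.mk' E (c a) (Z₂ a) : TangentBundle I M)).2 := by
    filter_upwards [hev] with a ha
    rw [← e.continuousLinearMapAt_apply_of_mem ℝ ha, ← e.continuousLinearMapAt_apply_of_mem ℝ ha,
      ← e.continuousLinearMapAt_apply_of_mem ℝ ha, map_add]
  exact (h₁'.2.add h₂'.2).congr_of_eventuallyEq heq

/-- Global form of `contMDiffAt_liftAlong_add`. [cite: ONeill1983, Ch. 4, p. 122] -/
theorem contMDiff_liftAlong_add {c : N → M} {Z₁ Z₂ : Π a : N, TangentSpace I (c a)}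
    (h₁ : ContMDiff J I.tangent k (fun a ↦ (TotalSpace.mk' E (c a) (Z₁ a) : TangentBundle I M)))
    (h₂ : ContMDiff J I.tangent k (fun a ↦ (TotalSpace.mk' E (c a) (Z₂ a) : TangentBundle I M))) :
    ContMDiff J I.tangent k
      (fun a ↦ (TotalSpace.mk' E (c a) (Z₁ a + Z₂ a) : TangentBundle I M)) :=
  fun a ↦ contMDiffAt_liftAlong_add (h₁ a) (h₂ a)

/-- **Negatives of smooth lifts are smooth lifts** (`-Z = (-1) • Z`). [cite: ONeill1983, Ch. 4, p. 122] -/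
theorem contMDiffAt_liftAlong_neg {c : N → M} {Z : Π a : N, TangentSpace I (c a)} {a₀ : N}
    (hZ : ContMDiffAt J I.tangent k (fun a ↦ (TotalSpace.mk' E (c a) (Z a) : TangentBundle I M)) a₀) :
    ContMDiffAt J I.tangent k
      (fun a ↦ (TotalSpace.mk' E (c a) (-Z a) : TangentBundle I M)) a₀ := by
  have h := contMDiffAt_liftAlong_smul (f := fun _ ↦ (-1 : ℝ)) hZ contMDiffAt_const
  refine h.congr_of_eventuallyEq (Filter.Eventually.of_forall fun a ↦ ?_)
  simp only [neg_smul, one_smul]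

end Literature.Geometry.Riemannian

end
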